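import Summits.BirchSwinnertonDyer.BirchSwinnertonDyer.Theorems.AlignedTransportAtTwoMainConjectureOfRankZeroBSDAtTwoHalfDescentLayerIndexTower
import Summits.BirchSwinnertonDyer.BirchSwinnertonDyer.Theorems.AlignedTransportAtTwoMainConjectureOfRankZeroBSDAtTwoSelmerLayerSplit
import Literature.NumberTheory.EllipticCurves.IwasawaEulerCharDualityProofs
import HarnessLib

/-!
# Route `AlignedTransportAtTwo`, crux C2 `MainConjectureOfRankZeroBSDAtTwo` (stmt-BirchSwinnertonDyer-22298):
# THE LAYER-GROWTH NUMBER IS AN INDEX, VI — SELMER CURRENCY: `#(X/ω_n X) = #Sel_{p^∞}(E/K_∞)^{Γ_n}` and `#(X/Ψ_n X) = #ker(N_n | Sel_{p^∞}(E/K_∞))`,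
# `N_n = ∑_{i<p} conj_γ^{pⁿ i}` the relative norm of `K_{n+1}/K_n`; hence for `X` without finite submodule the KERNEL OF THE RELATIVE NORM on the limit Selmer
# group has order `p^{φ(p^{n+1})·μ + λ}` at every high layer, and Iwasawa's formula for `#Sel_∞^{Γ_n}` is EXACT from the first high layer

HONEST FRAMING (cell `bsd-f1-sign2`, WIDTH-5 attached prover seat `bsd-line-att-p5` gen 54 on line `birth` of the lead `bsd-line-att-p2`;
`--supports` stmt-BirchSwinnertonDyer-22298, closes nothing; BSD is NOT proved by any of this; the crux C2, its verdict «blocked-on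
`Rank1Residual.GreenbergMuConjectureIrreducible`» and every registered stub (P / T / Kμ / LimDoor / MuIneqʳ / PFμ⁺) are untouched). THEOREMS ONLY — no `def`,
no instance, no named fact, no `sorry`; «`X` has no non-zero finite submodule» is the DISPLAYED hypothesis `hnf`
(Greenberg Prop. 4.14–4.15), never assumed as a fact. Sequel of this gen's files I–V (`…HalfDescentLayer{Ring,Index,IndexModule,IndexDatum,IndexTower}`) composed
with g40's Pontryagin pairs (`…SelmerLayerDuality.exists_addEquiv_layerQuotient_characterModule_selmerInvariants`: `X/ω_nX ≃+ Hom(Sel_∞^{Γ_n}, ℚ/ℤ)`;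
`IsDualPair.exists_quotient_addEquiv_of_smul` at the pair `(Ψ_n, N_n)`, `…SelmerLayerSplit.toDual_cyclotomicFactor_smul`) and `#Hom(A, ℚ/ℤ) = #A`
(`PontryaginCard.natCard_eq_of_addEquiv_characterModule`). Everything at the level of the LIMIT Selmer group `Sel_{p^∞}(E/K_∞)` (any number field `K`, any `ℤ_p`-extension,
any Pontryagin-dual datum); the passage to `Sel_{p^∞}(E/K_n)` is control (g39/g40, displayed finite kernels) and is NOT re-done here.

* §1 (any `K`, `κ`, `γ`, `D`) `natCard_layerQuotient_omega_eq_natCard_selmerInvariants` (**`#(X/ω_nX) = #Sel_∞^{Γ_n}`**),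
  `natCard_layerQuotient_cyclotomic_eq_natCard_endInvariants` (**`#(X/Ψ_nX) = #ker N_n`**, `N_n = ∑_{i<p}(conj_γ^{pⁿ})^i` on `Sel_∞`).
* §2 (`X = D.X` f.g. torsion WITHOUT finite submodule, `char_Λ X = (f)`) ★★★ **`natCard_endInvariants_relNorm_eq_pow`: `#ker(N_n | Sel_∞) = p^{pⁿ(p−1)·μ(f) + λ(f)}`
  at every `n` with `λ(f) < pⁿ(p−1)`**; ★★ `natCard_selmerInvariants_succ_eq_mul` (`#Sel_∞^{Γ_{n+1}} = #Sel_∞^{Γ_n} · #ker N_n` when `f` is coprime to `ω_n`);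
  ★★★ **`natCard_selmerInvariants_mul_pow_eq` — IWASAWA'S THEOREM FOR `Sel_∞^{Γ_n}`, EXACT: `#Sel_∞^{Γ_n}·p^{μp^{n₀}+λn₀} = #Sel_∞^{Γ_{n₀}}·p^{μpⁿ+λn}` for all
  `n ≥ n₀`** (`f(0) ≠ 0`, `Ψ_m ∤ f` below `n₀`, `λ(f) < p^{n₀}(p−1)`).
* Sequel `…HalfDescentLayerIndexSelmerDatum` (`K = ℚ`, cyclotomic, PRINT `h17` = Kato 17.4): `char_Λ X = (G) ⟺ #ker(N_n | Sel_{p^∞}(W/ℚ_∞)) = p^{pⁿ(p−1)·μ(G) + λ(G)}`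
  at ONE `n` with `λ(G) < pⁿ(p−1)`; `p = 2`, `μ(G) = 0`: `#ker(N_n | Sel_{2^∞}(W/ℚ_∞)) = 2^{λ_an}` ⟹ `μ(f_X) = 0 ∧ λ(f_X) = λ_an ∧ char X = (G)`.
Memo `Cruxes/MainConjectureOfRankZeroBSDAtTwo/LAYER-INDEX-att-p5-g54.md`. BSD is not proved by any of this; nothing about any curve's BSD₂ is asserted here.

References: R. Greenberg, LNM 1716 (1999), §1 pp. 60–65, §3 p. 85, Prop. 4.14–4.15, p. 180 [GreenbergLNM1716]; L. Washington, GTM 83, §13.3 Thm. 13.13, §13.4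
[Washington1997]; K. Kato, Astérisque 295 (2004) Thm. 17.4 [Kato2004Asterisque]; B. Perrin-Riou / P. Schneider (relative norms in the cyclotomic tower, folklore).
-/

set_option linter.dupNamespace false
set_option autoImplicit false

noncomputable section

open scoped Classical AddSubgroup Polynomial

universe u v

namespace Summit.BirchSwinnertonDyer.BirchSwinnertonDyer.Theorems.AlignedTransportAtTwoHalfDescentLayerIndexSelmer

open WeierstrassCurve Literature.NumberTheory.EllipticCurves Literature.NumberTheory.EllipticCurves.IwasawaDual
  Literature.NumberTheory.EllipticCurves.IwasawaAlgebra
  Summit.BirchSwinnertonDyer.Rank1Residual.X1.MuLambda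
  Summit.BirchSwinnertonDyer.Rank1Residual.Iwasawa
  Summit.BirchSwinnertonDyer.BirchSwinnertonDyer.Theorems.DefectPrime
  Summit.BirchSwinnertonDyer.BirchSwinnertonDyer.Theorems.AlignedTransportAtTwoCyclotomicLayerPrime
  Summit.BirchSwinnertonDyer.BirchSwinnertonDyer.Theorems.AlignedTransportAtTwoSelmerLayerDuality
  Summit.BirchSwinnertonDyer.BirchSwinnertonDyer.Theorems.AlignedTransportAtTwoSelmerLayerSplit
  Summit.BirchSwinnertonDyer.BirchSwinnertonDyer.Theorems.AlignedTransportAtTwoHalfDescentLayerIndexModule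
  Summit.BirchSwinnertonDyer.BirchSwinnertonDyer.Theorems.AlignedTransportAtTwoHalfDescentLayerIndexTower

/-! ## §1 The two Pontryagin identifications: `#(X/ω_nX) = #Sel_∞^{Γ_n}`, `#(X/Ψ_nX) = #ker N_n` -/

section Pontryagin

variable {K : Type u} [Field K] [NumberField K] (W : WeierstrassCurve K) {p : ℕ} [hp : Fact p.Prime] (κ : ZpExtension K p)
  {γ : Field.absoluteGaloisGroup K}

/-- **`#(X/ω_n X) = #Sel_{p^∞}(E/K_∞)^{Γ_n}`** (`Nat.card`; both sides `0` when infinite): g40's `X/ω_nX ≃+ Hom(Sel_∞^{Γ_n}, ℚ/ℤ)` and `#Hom(A, ℚ/ℤ) = #A`.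
[cite: GreenbergLNM1716, §1 p. 62 and §3 p. 85] [cite: Washington1997, §13.4] -/
theorem natCard_layerQuotient_omega_eq_natCard_selmerInvariants (hγ : κ.IsTopGenerator γ) (D : W.SelmerDualData κ γ) (n : ℕ) :
    Nat.card (D.X ⧸ (Ideal.span {((1 + PowerSeries.X : PowerSeries ℤ_[p]) ^ (p ^ n) - 1 : IwasawaAlgebra p)} • ⊤ :
        Submodule (IwasawaAlgebra p) D.X)) = Nat.card ↥(W.selmerInfty κ ⊓ W.layerInvariants κ n) := by
  obtain ⟨Ψ, -⟩ := exists_addEquiv_layerQuotient_characterModule_selmerInvariants p W κ hγ D n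
  exact PontryaginCard.natCard_eq_of_addEquiv_characterModule Ψ

/-- **`#(X/Ψ_n X) = #ker(N_n | Sel_{p^∞}(E/K_∞))`**, `N_n = ∑_{i<p} (conj_γ^{pⁿ})^i` the relative-norm operator of the layer `K_{n+1}/K_n`
(`Ψ_n = Φ_{p^{n+1}}(1+T) = ∑_{i<p}((1+T)^{pⁿ})^i` acts on `X` as `N_n` on `Sel_∞`; Pontryagin duality at the pair `(Ψ_n, N_n)`).
[cite: GreenbergLNM1716, §1 pp. 60, 65] -/
theorem natCard_layerQuotient_cyclotomic_eq_natCard_endInvariants (hγ : κ.IsTopGenerator γ) (D : W.SelmerDualData κ γ) (n : ℕ) :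
    Nat.card (D.X ⧸ (Ideal.span {(((Polynomial.cyclotomic (p ^ (n + 1)) ℤ_[p]).comp (Polynomial.X + 1) : ℤ_[p][X]) : IwasawaAlgebra p)} • ⊤ :
        Submodule (IwasawaAlgebra p) D.X)) =
      Nat.card ↥(endInvariants (∑ i ∈ Finset.range p, ((W.conjSelmerInfty κ γ) ^ (p ^ n)) ^ i)) := by
  obtain ⟨Ψ, -⟩ := (D.isDualPair W hγ).exists_quotient_addEquiv_of_smul (toDual_cyclotomicFactor_smul W κ hγ D n)
  rw [coe_cyclotomicLayer_eq_sum p n]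
  exact PontryaginCard.natCard_eq_of_addEquiv_characterModule Ψ

end Pontryagin

/-! ## §2 The kernel of the relative norm has order `p^{φ(p^{n+1})·μ + λ}`; Iwasawa's formula for `#Sel_∞^{Γ_n}`, exact -/

section NoFinite

variable {K : Type u} [Field K] [NumberField K] (W : WeierstrassCurve K) {p : ℕ} [hp : Fact p.Prime] (κ : ZpExtension K p)
  {γ : Field.absoluteGaloisGroup K}

/-- ★★★ **THE KERNEL OF THE RELATIVE NORM ON THE LIMIT SELMER GROUP.** `E/K`, any `ℤ_p`-extension `κ` with topological generator `γ`, a Pontryagin-dual datum `D`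
whose `X` is finitely generated torsion WITHOUT non-zero finite submodule, `char_Λ X = (f)`. Then at every layer `n` with `λ(f) < pⁿ(p−1)`:
**`#{s ∈ Sel_{p^∞}(E/K_∞) : N_n s = 0} = p^{pⁿ(p−1)·μ(f) + λ(f)}`**, `N_n = ∑_{i<p}(conj_γ^{pⁿ})^i`. [cite: GreenbergLNM1716, §1 pp. 60–65 and Prop. 4.14–4.15]
[cite: Washington1997, §13.3 Thm. 13.13] -/
theorem natCard_endInvariants_relNorm_eq_pow (hγ : κ.IsTopGenerator γ) (D : W.SelmerDualData κ γ) [Module.Finite (IwasawaAlgebra p) D.X]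
    (hD : D.IsTorsion) (hnf : ∀ N' : Submodule (IwasawaAlgebra p) D.X, Finite N' → N' = ⊥) {f : IwasawaAlgebra p}
    (hchar : D.charIdeal = Ideal.span {f}) {n : ℕ} (hlam : lam f < p ^ n * (p - 1)) :
    Nat.card ↥(endInvariants (∑ i ∈ Finset.range p, ((W.conjSelmerInfty κ γ) ^ (p ^ n)) ^ i)) = p ^ (p ^ n * (p - 1) * mu f + lam f) := by
  rw [← natCard_layerQuotient_cyclotomic_eq_natCard_endInvariants W κ hγ D n]
  exact natCard_layerQuotient_eq_pow (M := D.X) hD hnf hchar hlam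

/-- ★★ **`#Sel_∞^{Γ_{n+1}} = #Sel_∞^{Γ_n} · #ker N_n`** when `f(0) ≠ 0` and `Ψ_m ∤ f` for `m < n` (`ω_n` acts injectively on `X`, file V); with the previous
theorem, for `λ(f) < pⁿ(p−1)`: `#Sel_∞^{Γ_{n+1}} = #Sel_∞^{Γ_n} · p^{pⁿ(p−1)μ(f) + λ(f)}` — g53's layer-growth number in Selmer currency.
[cite: GreenbergLNM1716, §1 p. 65 and §3 p. 85] [cite: Washington1997, §13.3 (Lemma 13.18)] -/
theorem natCard_selmerInvariants_succ_eq_mul (hγ : κ.IsTopGenerator γ) (D : W.SelmerDualData κ γ) [Module.Finite (IwasawaAlgebra p) D.X]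
    (hD : D.IsTorsion) (hnf : ∀ N' : Submodule (IwasawaAlgebra p) D.X, Finite N' → N' = ⊥) {f : IwasawaAlgebra p}
    (hchar : D.charIdeal = Ideal.span {f}) (h0 : PowerSeries.constantCoeff f ≠ 0) {n : ℕ}
    (hΨ : ∀ m < n, ¬ ((((Polynomial.cyclotomic (p ^ (m + 1)) ℤ_[p]).comp (Polynomial.X + 1) : ℤ_[p][X]) : IwasawaAlgebra p) ∣ f)) :
    Nat.card ↥(W.selmerInfty κ ⊓ W.layerInvariants κ (n + 1)) =
      Nat.card ↥(W.selmerInfty κ ⊓ W.layerInvariants κ n) * Nat.card ↥(endInvariants (∑ i ∈ Finset.range p, ((W.conjSelmerInfty κ γ) ^ (p ^ n)) ^ i)) ∧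
    (lam f < p ^ n * (p - 1) →
      Nat.card ↥(W.selmerInfty κ ⊓ W.layerInvariants κ (n + 1)) = Nat.card ↥(W.selmerInfty κ ⊓ W.layerInvariants κ n) * p ^ (p ^ n * (p - 1) * mu f + lam f)) := by
  have hf := smul_eq_zero_of_charIdeal_eq_span_of_noFiniteSubmodule p D.X hD hnf hchar
  have hstep : Nat.card ↥(W.selmerInfty κ ⊓ W.layerInvariants κ (n + 1)) =
      Nat.card ↥(W.selmerInfty κ ⊓ W.layerInvariants κ n) * Nat.card ↥(endInvariants (∑ i ∈ Finset.range p, ((W.conjSelmerInfty κ γ) ^ (p ^ n)) ^ i)) := by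
    rw [← natCard_layerQuotient_omega_eq_natCard_selmerInvariants W κ hγ D (n + 1), ← natCard_layerQuotient_omega_eq_natCard_selmerInvariants W κ hγ D n,
      ← natCard_layerQuotient_cyclotomic_eq_natCard_endInvariants W κ hγ D n, ← coe_cyclotomicLayer_mul_omega p n]
    exact natCard_quotient_span_mul_smul_top' _ _ (omega_smul_eq_zero_imp hnf hf h0 hΨ)
  exact ⟨hstep, fun hlam ↦ by rw [hstep, natCard_endInvariants_relNorm_eq_pow W κ hγ D hD hnf hchar hlam]⟩

/-- ★★★ **IWASAWA'S THEOREM FOR `Sel_{p^∞}(E/K_∞)^{Γ_n}`, EXACT from the first high layer.** Same setting, `f(0) ≠ 0`, `Ψ_m ∤ f` for `m < n₀`, `λ(f) < p^{n₀}(p−1)`.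
Then for every `n ≥ n₀`: **`#Sel_∞^{Γ_n} · p^{μ(f)p^{n₀} + λ(f)n₀} = #Sel_∞^{Γ_{n₀}} · p^{μ(f)pⁿ + λ(f)n}`** — `#Sel_∞^{Γ_n} = p^{μpⁿ + λn + ν}` with EXPLICIT `ν` and `n₀`.
[cite: GreenbergLNM1716, Thm. 1.10 and §3 p. 85] [cite: Washington1997, §13.3 Thm. 13.13] -/
theorem natCard_selmerInvariants_mul_pow_eq (hγ : κ.IsTopGenerator γ) (D : W.SelmerDualData κ γ) [Module.Finite (IwasawaAlgebra p) D.X]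
    (hD : D.IsTorsion) (hnf : ∀ N' : Submodule (IwasawaAlgebra p) D.X, Finite N' → N' = ⊥) {f : IwasawaAlgebra p}
    (hchar : D.charIdeal = Ideal.span {f}) (h0 : PowerSeries.constantCoeff f ≠ 0) {n₀ : ℕ}
    (hΨ : ∀ m < n₀, ¬ ((((Polynomial.cyclotomic (p ^ (m + 1)) ℤ_[p]).comp (Polynomial.X + 1) : ℤ_[p][X]) : IwasawaAlgebra p) ∣ f))
    (hlam : lam f < p ^ n₀ * (p - 1)) {n : ℕ} (hn : n₀ ≤ n) :
    Nat.card ↥(W.selmerInfty κ ⊓ W.layerInvariants κ n) * p ^ (mu f * p ^ n₀ + lam f * n₀) =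
      Nat.card ↥(W.selmerInfty κ ⊓ W.layerInvariants κ n₀) * p ^ (mu f * p ^ n + lam f * n) := by
  rw [← natCard_layerQuotient_omega_eq_natCard_selmerInvariants W κ hγ D n, ← natCard_layerQuotient_omega_eq_natCard_selmerInvariants W κ hγ D n₀]
  exact natCard_quotient_omega_mul_pow_eq (M := D.X) hD hnf hchar h0 hΨ hlam hn

end NoFinite

end Summit.BirchSwinnertonDyer.BirchSwinnertonDyer.Theorems.AlignedTransportAtTwoHalfDescentLayerIndexSelmer

end
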